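import Summits.BirchSwinnertonDyer.BirchSwinnertonDyer.Theorems.ByReductionTypeAtTwoRankOneAtTwoOffBigImageOddLocalEngineStepB
import HarnessLib

/-!
# Route `ByReductionTypeAtTwo`, crux `RankOneAtTwoOffBigImageOddLocal` (stmt-BirchSwinnertonDyer-23716), line
# `refined_kolyvagin_tamagawa_shift_at_two` — ENGINE PORT `c₀ ↦ h₀` (regular element), §I / §I′ regular supply by RAMIFIED INERTIA (card E1c′)

Lead prover `prover-cruxlead-stmt-BirchSwinnertonDyer-23716-g0` (2026-08-28), landing the crux-plan g6 ENGINE QUARRY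
`Cruxes/RankOneAtTwoOffBigImageOddLocal/RefinedKolyvaginEngineG6.lean` (planner `cruxplan-…-23716-refined-kolyvag-9ff2fe475f-g6`, v10, ≈2800 lines,
rc 0 / 0 sorry; `Cruxes/` files are not importable, so the lead COPIES the proofs into `Theorems/` — card «LEAD QUICKSTART (g6)» Q2 #3 / Q4) as
`--supports stmt-BirchSwinnertonDyer-23716` helpers, continuing `…Engine{Dictionary,Parity,Cyclotomic,CyclotomicBasis,GoursatLift,Chebotarev,RegularSupply,
RegularLift}.lean`.  The engine port = kernel-closable item #3 of the pen's order (PEN-PICK-23716 ADD-4): Kolyvagin primes whose Frobenius is a REGULAR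
element `h₀` (det `−1`, trace `0`, odd mod `2`; LOSSLESS local Kummer maps by R1/LKL) instead of complex conjugation `c₀` (which loses the top bit at
`Δ > 0`, residual 24883), with McCallum's exact local orders — the supply the line's filtered stubs `…WithOn Φ_reg Ω` consume (card #7
`regular-frobenius-kolyvagin-primes-pos-disc`).  THIS FILE: §I — a second, character-free road to the regular lift: for a Heegner/door field `K` with an odd RAMIFIED prime, the image `G ⊂ Aut(E[n]) × Gal(K/ℚ)` contains `(1, τ)` (`exists_smul_torsion_eq_self_and_not_mem_range`, `exists_smul_eq_addAut_and_not_mem_range` from `ρ̄_{E,n}` onto, `exists_eq_mul_absGaloisRestrict`, `exists_mul_absGaloisRestrict_smul_eq_addAut`); §I′ — the discriminant form via the tree's `ShimuraKolyvaginImageDisjoint.exists_absGaloisRestrict_smul_eq` (`ρ̄_{E,n}(res Γ_K) = ρ̄_{E,n}(Γ_ℚ)`): `exists_mul_absGaloisRestrict_smul_eq_addAut_of_dvd_discr / _of_doorAdmissible / _of_heegner` — EVERY additive automorphism of `E[n]` is `c₀ · res ρ₀` for some `ρ₀ ∈ Γ_K`.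

Statements and proofs are the quarry's VERBATIM (namespace moved to `…Theorems.OffBigImageOddLocalAtTwo.Engine`).  Nothing here proves the crux,
`BSDp W 2`, BSD or the summit; no registered stub is discharged (engine inputs only).  BSD is not proved.

Refs: [GrossLMS1991] §3 (3.1)–(3.3), §9; [McCallumLMS1991] §3 (Cor. 3.2, Prop. 3.1), §5; [SilvermanAEC2009] III.7–III.8, VII–VIII; Serre (1972) §5.3.
-/

set_option linter.dupNamespace false -- tree convention: `Summit.BirchSwinnertonDyer.BirchSwinnertonDyer.Theorems` (summit = sub-problem)
set_option autoImplicit false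

noncomputable section

namespace Summit.BirchSwinnertonDyer.BirchSwinnertonDyer.Theorems.OffBigImageOddLocalAtTwo.Engine

/-! ## §I  Regular supply by RAMIFIED INERTIA (card E1c′, PROVED): `(1, τ) ∈ G` for every Heegner field with an odd ramified prime

(`K : Type` in universe `0`, as in the skeleton's stubs `∀ (K : Type) [Field K] [NumberField K], IsImaginaryQuadratic K → Odd (NumberField.discr K) → …`
and as required by the tree's `exists_mem_inertia_not_mem_range`.) -/

section RegularSupplyI

open scoped Pointwise
open WeierstrassCurve NumberField IsDedekindDomain Field
open Literature.NumberTheory.GaloisRepresentations Literature.NumberTheory.EllipticCurves Literature.NumberTheory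

variable {W : WeierstrassCurve ℚ} {K : Type} [Field K] [NumberField K]

/-- Group lemma: if `φ : G ↠ H` kills some `g ∉ U`, every `R : H` lifts OUTSIDE `U`. [folklore] -/
theorem exists_apply_eq_and_not_mem {G H : Type*} [Group G] [Group H] (φ : G →* H)
    (hφ : Function.Surjective φ) (U : Subgroup G) {g : G} (hgU : g ∉ U) (hg : φ g = 1) (R : H) :
    ∃ h : G, φ h = R ∧ h ∉ U := by
  obtain ⟨h₁, rfl⟩ := hφ R
  by_cases h₁U : h₁ ∈ U
  · refine ⟨h₁ * g, by rw [map_mul, hg, mul_one], fun hmem ↦ hgU ?_⟩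
    have := U.mul_mem (U.inv_mem h₁U) hmem
    rwa [inv_mul_cancel_left] at this
  · exact ⟨h₁, rfl, h₁U⟩

/-- **E1c′ (inertia).**  At a place `v` of GOOD reduction of `E/ℚ` with `n ∉ v` under which `K` has a UNIQUE prime `w` of residue
degree `1` (for `[K:ℚ] = 2`: `v` ramifies in `K`), some `g ∈ Γ_ℚ` acts TRIVIALLY on `E(ℚ̄)[n]` (inertia at good `v ∤ n`,
`smul_geomTorsion_eq_of_mem_inertia`, AEC VII.4.1) and restricts NON-trivially to `K` (`exists_mem_inertia_not_mem_range`,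
Neukirch I.§9).  In the language of §C/§G: the graph group `G ≤ Aut(E[n]) × Gal(K/ℚ)` contains `(1, τ)`, so §C's dichotomy is
decided WITHOUT the character classification of §B/§G. [cite: SilvermanAEC2009, VII.4.1] [cite: NeukirchANT1999, I.§9] -/
theorem exists_smul_torsion_eq_self_and_not_mem_range [W.IsElliptic] {n : ℤ}
    {v : HeightOneSpectrum (𝓞 ℚ)} (hgood : W.HasGoodReductionAt v) (hn : (n : 𝓞 ℚ) ∉ v.asIdeal)
    {w : HeightOneSpectrum (𝓞 K)} (hw : w.asIdeal.under (𝓞 ℚ) = v.asIdeal)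
    (huniq : ∀ w' : HeightOneSpectrum (𝓞 K), w'.asIdeal.under (𝓞 ℚ) = v.asIdeal → w' = w)
    (hf : w.asIdeal.inertiaDeg (𝓞 ℚ) = 1) (hH : (absGaloisRestrict ℚ K).range ≠ ⊤) :
    ∃ g : absoluteGaloisGroup ℚ, g ∉ (absGaloisRestrict ℚ K).range ∧
      ∀ P : geomTorsion W n, g • P = P := by
  classical
  obtain ⟨𝔔, h𝔔⟩ := HeightOneSpectrum.primesAbove_nonempty w
  have h𝔓 := comap_absIntegersMap_mem_primesAbove hw h𝔔
  obtain ⟨g, hgI, hgU⟩ := exists_mem_inertia_not_mem_range (F := ℚ) (M := K) hw huniq h𝔔 hf hH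
  exact ⟨g, hgU, fun P ↦ W.smul_geomTorsion_eq_of_mem_inertia hgood hn h𝔓 hgI P⟩

/-- **E1c′ (regular supply).**  With the mod-`n` representation SURJECTIVE onto `Aut(E(ℚ̄)[n])` (the crux's full-2-adic-image
binder at `n = 2^{M+1}`) and a ramified good place as above, EVERY additive automorphism `A` of `E(ℚ̄)[n]` — in particular the
regular involution `[[1,1],[0,-1]]` of any basis — is the action of some `h₀ ∈ Γ_ℚ` restricting NON-trivially to `K`. [folklore] -/
theorem exists_smul_eq_addAut_and_not_mem_range [W.IsElliptic] {n : ℤ} (hsurj : W.HasSurjectiveModNGaloisRep n)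
    {v : HeightOneSpectrum (𝓞 ℚ)} (hgood : W.HasGoodReductionAt v) (hn : (n : 𝓞 ℚ) ∉ v.asIdeal)
    {w : HeightOneSpectrum (𝓞 K)} (hw : w.asIdeal.under (𝓞 ℚ) = v.asIdeal)
    (huniq : ∀ w' : HeightOneSpectrum (𝓞 K), w'.asIdeal.under (𝓞 ℚ) = v.asIdeal → w' = w)
    (hf : w.asIdeal.inertiaDeg (𝓞 ℚ) = 1) (hH : (absGaloisRestrict ℚ K).range ≠ ⊤)
    (A : AddAut (geomTorsion W n)) :
    ∃ h₀ : absoluteGaloisGroup ℚ, h₀ ∉ (absGaloisRestrict ℚ K).range ∧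
      ∀ P : geomTorsion W n, h₀ • P = A P := by
  obtain ⟨g, hgU, hg⟩ := exists_smul_torsion_eq_self_and_not_mem_range hgood hn hw huniq hf hH
  have hg1 : galoisRepTorsion W n g = 1 :=
    Multiplicative.toAdd.injective (AddEquiv.ext fun P ↦ by rw [galoisRepTorsion_apply]; exact hg P)
  obtain ⟨h₀, hh₀, hU⟩ :=
    exists_apply_eq_and_not_mem (galoisRepTorsion W n) hsurj _ hgU hg1 (Multiplicative.ofAdd A)
  refine ⟨h₀, hU, fun P ↦ ?_⟩
  rw [← galoisRepTorsion_apply, hh₀]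
  rfl

/-- Index two: two elements outside `Γ_K ≤ Γ_ℚ` differ by an element of `Γ_K` — `h₀ = c₀ · res ρ₀`. [folklore] -/
theorem exists_eq_mul_absGaloisRestrict (hK2 : Module.finrank ℚ K = 2) {c₀ h₀ : absoluteGaloisGroup ℚ}
    (hc₀ : c₀ ∉ (absGaloisRestrict ℚ K).range) (hh₀ : h₀ ∉ (absGaloisRestrict ℚ K).range) :
    ∃ ρ₀ : absoluteGaloisGroup K, h₀ = c₀ * absGaloisRestrict ℚ K ρ₀ := by
  have hidx : (absGaloisRestrict ℚ K).range.index = 2 :=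
    (index_range_absGaloisRestrict_eq_finrank ℚ K).trans hK2
  have hmem : c₀⁻¹ * h₀ ∈ (absGaloisRestrict ℚ K).range := by
    rw [Subgroup.mul_mem_iff_of_index_two hidx, Subgroup.inv_mem_iff]
    exact ⟨fun h ↦ absurd h hc₀, fun h ↦ absurd h hh₀⟩
  obtain ⟨ρ₀, hρ₀⟩ := hmem
  refine ⟨ρ₀, ?_⟩
  change absGaloisRestrict ℚ K ρ₀ = c₀⁻¹ * h₀ at hρ₀
  rw [hρ₀, mul_inv_cancel_left]

/-- **E1c′ assembled for an imaginary quadratic `K`:** with complex conjugation `c₀`, surjectivity of `ρ_{E,n}` and a good place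
`v ∤ n` ramified in `K`, every `A ∈ Aut(E(ℚ̄)[n])` is the action of `h₀ = c₀ · res ρ₀` for some `ρ₀ ∈ Γ_K` — the input `ρ₀` of
§H `exists_galoisElement_regular_rat` (take `n = 2^{M+1}` or `2^M` and `A` regular). [folklore] -/
theorem exists_mul_absGaloisRestrict_smul_eq_addAut [W.IsElliptic] (hK : IsImaginaryQuadratic K)
    {c₀ : absoluteGaloisGroup ℚ} (hc₀ : IsComplexConjugation (Rat.castHom ℝ) c₀)
    {n : ℤ} (hsurj : W.HasSurjectiveModNGaloisRep n)
    {v : HeightOneSpectrum (𝓞 ℚ)} (hgood : W.HasGoodReductionAt v) (hn : (n : 𝓞 ℚ) ∉ v.asIdeal)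
    {w : HeightOneSpectrum (𝓞 K)} (hw : w.asIdeal.under (𝓞 ℚ) = v.asIdeal)
    (huniq : ∀ w' : HeightOneSpectrum (𝓞 K), w'.asIdeal.under (𝓞 ℚ) = v.asIdeal → w' = w)
    (hf : w.asIdeal.inertiaDeg (𝓞 ℚ) = 1) (A : AddAut (geomTorsion W n)) :
    ∃ ρ₀ : absoluteGaloisGroup K, ∀ P : geomTorsion W n, (c₀ * absGaloisRestrict ℚ K ρ₀) • P = A P := by
  haveI : IsTotallyComplex K := hK.2
  have hc₀U : c₀ ∉ (absGaloisRestrict ℚ K).range :=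
    hc₀.not_mem_range_absGaloisRestrict (L := K) IsTotallyComplex.isComplex
  have hH : (absGaloisRestrict ℚ K).range ≠ ⊤ := fun h ↦ hc₀U (h ▸ Subgroup.mem_top c₀)
  obtain ⟨h₀, hh₀U, hh₀⟩ := exists_smul_eq_addAut_and_not_mem_range hsurj hgood hn hw huniq hf hH A
  obtain ⟨ρ₀, rfl⟩ := exists_eq_mul_absGaloisRestrict hK.1 hc₀U hh₀U
  exact ⟨ρ₀, hh₀⟩

end RegularSupplyI

/-! ## §I′  Regular supply from a RAMIFIED prime of `K` — discriminant form, via the tree's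
`ShimuraKolyvaginImageDisjoint.exists_absGaloisRestrict_smul_eq` (Gross 1991 §9: `ρ̄_{E,n}(res Γ_K) = ρ̄_{E,n}(Γ_ℚ)`). -/

section RegularSupplyI2

open WeierstrassCurve NumberField IsDedekindDomain Field
open Literature.NumberTheory.GaloisRepresentations Literature.NumberTheory.EllipticCurves Literature.NumberTheory
open Summit.BirchSwinnertonDyer.BirchSwinnertonDyer.Theorems

universe u

variable {W : WeierstrassCurve ℚ} {K : Type u} [Field K] [NumberField K]

/-- **E1c′ (discriminant form).**  `[K:ℚ] = 2`, a prime `q ∣ d_K` with `q ∤ N_E`, `q ∤ n`, and `ρ̄_{E,n}` SURJECTIVE onto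
`Aut(E(ℚ̄)[n])`: for ANY `c₀ ∈ Γ_ℚ` and ANY additive automorphism `A` of `E(ℚ̄)[n]` some `ρ₀ ∈ Γ_K` has
`c₀ · res ρ₀` acting as `A` — because `ρ̄(res Γ_K) = ρ̄(Γ_ℚ)` (tree `ShimuraKolyvaginImageDisjoint.exists_absGaloisRestrict_smul_eq`,
applied to `c₀⁻¹ γ₁` with `ρ̄(γ₁) = A`).  No hypothesis on `c₀`. [cite: GrossLMS1991, §9 (PDF p. 227, before Prop. 9.1)] -/
theorem exists_mul_absGaloisRestrict_smul_eq_addAut_of_dvd_discr [W.IsElliptic]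
    (hK2 : Module.finrank ℚ K = 2) {q : ℕ} (hq : q.Prime) (hqd : (q : ℤ) ∣ NumberField.discr K)
    (hqN : ¬ q ∣ W.conductorNorm ℤ) {n : ℤ} (hqn : ¬ (q : ℤ) ∣ n)
    (hsurj : W.HasSurjectiveModNGaloisRep n) (c₀ : absoluteGaloisGroup ℚ)
    (A : AddAut (geomTorsion W n)) :
    ∃ ρ₀ : absoluteGaloisGroup K, ∀ P : geomTorsion W n,
      (c₀ * absGaloisRestrict ℚ K ρ₀) • P = A P := by
  obtain ⟨γ₁, hγ₁⟩ := hsurj (Multiplicative.ofAdd A)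
  obtain ⟨g, hg⟩ := ShimuraKolyvaginImageDisjoint.exists_absGaloisRestrict_smul_eq W K hK2 hq hqd
    hqN hqn (c₀⁻¹ * γ₁)
  refine ⟨g, fun P ↦ ?_⟩
  rw [mul_smul, hg, ← mul_smul, mul_inv_cancel_left, ← galoisRepTorsion_apply, hγ₁]
  rfl

/-- **E1c′ in the skeleton's vocabulary.**  For `K` imaginary quadratic with `d_K` DOOR-ADMISSIBLE for `E` (so `d_K ≡ 1 (mod 8)` is
odd and `E` has good reduction at every prime `q ∣ d_K`) and `ρ̄_{E,2^k}` surjective, EVERY additive automorphism of `E(ℚ̄)[2^k]`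
is the action of `c₀ · res ρ₀` for some `ρ₀ ∈ Γ_K` — for ANY `c₀ ∈ Γ_ℚ` (in the engine: complex conjugation).  Some prime
divides `d_K` (Minkowski, tree `exists_prime_dvd_discr`); it is odd, hence prime to `2^k`, and of good reduction, hence prime
to `N_E` (`dvd_conductorNorm_iff_not_hasGoodReductionAtPrime`). [cite: GrossLMS1991, §9 (PDF p. 227, before Prop. 9.1)] -/
theorem exists_mul_absGaloisRestrict_smul_eq_addAut_of_doorAdmissible [W.IsElliptic] [W.IsGloballyMinimal]
    (hK : IsImaginaryQuadratic K) (hD : RankOneAtTwoOneDoor.DoorAdmissible W (NumberField.discr K))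
    {k : ℕ} (hsurj : W.HasSurjectiveModNGaloisRep ((2 ^ k : ℕ) : ℤ)) (c₀ : absoluteGaloisGroup ℚ)
    (A : AddAut (geomTorsion W ((2 ^ k : ℕ) : ℤ))) :
    ∃ ρ₀ : absoluteGaloisGroup K, ∀ P : geomTorsion W ((2 ^ k : ℕ) : ℤ),
      (c₀ * absGaloisRestrict ℚ K ρ₀) • P = A P := by
  have hK2 : Module.finrank ℚ K = 2 := hK.1
  obtain ⟨q, hq, hqd⟩ := ShimuraKolyvaginImageDisjoint.exists_prime_dvd_discr K (by omega)
  obtain ⟨-, -, h8, hgoodAll, -⟩ := hD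
  haveI : Fact q.Prime := ⟨hq⟩
  have hgood : W.HasGoodReductionAtPrime q := hgoodAll q hq hqd ⟨hq⟩
  have hqN : ¬ q ∣ W.conductorNorm ℤ := fun h ↦
    (W.dvd_conductorNorm_iff_not_hasGoodReductionAtPrime q).mp h hgood
  have hq2 : q ≠ 2 := by
    rintro rfl
    have h2 : (2 : ℤ) ∣ NumberField.discr K := by exact_mod_cast hqd
    omega
  have hqn : ¬ (q : ℤ) ∣ ((2 ^ k : ℕ) : ℤ) := by
    intro h
    have h' : q ∣ 2 ^ k := by exact_mod_cast h
    exact hq2 ((Nat.prime_dvd_prime_iff_eq hq Nat.prime_two).mp (hq.dvd_of_dvd_pow h'))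
  exact exists_mul_absGaloisRestrict_smul_eq_addAut_of_dvd_discr hK2 hq hqd hqN hqn hsurj c₀ A

/-- **E1c′ for the big-image stubs S3/S4/S5** (binders `IsImaginaryQuadratic K`, `Odd d_K`, `SatisfiesHeegnerHypothesis N_E K`, `ρ̄_{E,2^k}` onto):
every additive automorphism of `E(ℚ̄)[2^k]` is the action of `c₀ · res ρ₀`, `ρ₀ ∈ Γ_K`, for ANY `c₀`.  The ramified prime: some `q ∣ d_K`
(Minkowski); `q ∤ N_E` because the primes of `N_E` split (Heegner) while `q` ramifies (tree `ShimuraKolyvaginImageInputs.exists_prime_dvd_discr_not_dvd`);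
`q` odd because `d_K` is. [cite: GrossLMS1991, §9 (PDF p. 227, before Prop. 9.1)] -/
theorem exists_mul_absGaloisRestrict_smul_eq_addAut_of_heegner [W.IsElliptic]
    (hK : IsImaginaryQuadratic K) (hodd : Odd (NumberField.discr K))
    (hH : SatisfiesHeegnerHypothesis (W.conductorNorm ℤ) K)
    {k : ℕ} (hsurj : W.HasSurjectiveModNGaloisRep ((2 ^ k : ℕ) : ℤ)) (c₀ : absoluteGaloisGroup ℚ)
    (A : AddAut (geomTorsion W ((2 ^ k : ℕ) : ℤ))) :
    ∃ ρ₀ : absoluteGaloisGroup K, ∀ P : geomTorsion W ((2 ^ k : ℕ) : ℤ),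
      (c₀ * absGaloisRestrict ℚ K ρ₀) • P = A P := by
  have hK2 : Module.finrank ℚ K = 2 := hK.1
  obtain ⟨q, hq, hqd, hqN⟩ := ShimuraKolyvaginImageInputs.exists_prime_dvd_discr_not_dvd K hK2
    (N := W.conductorNorm ℤ) ∅ (by simp) (fun ℓ hℓ hℓN _ ↦ hH ℓ hℓ hℓN)
  have hq2 : q ≠ 2 := by
    rintro rfl
    have h2 : (2 : ℤ) ∣ NumberField.discr K := by exact_mod_cast hqd
    exact (Int.not_even_iff_odd.mpr hodd) (even_iff_two_dvd.mpr h2)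
  have hqn : ¬ (q : ℤ) ∣ ((2 ^ k : ℕ) : ℤ) := by
    intro h
    have h' : q ∣ 2 ^ k := by exact_mod_cast h
    exact hq2 ((Nat.prime_dvd_prime_iff_eq hq Nat.prime_two).mp (hq.dvd_of_dvd_pow h'))
  exact exists_mul_absGaloisRestrict_smul_eq_addAut_of_dvd_discr hK2 hq hqd hqN hqn hsurj c₀ A

end RegularSupplyI2

end Summit.BirchSwinnertonDyer.BirchSwinnertonDyer.Theorems.OffBigImageOddLocalAtTwo.Engine

end
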